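import Mathlib.Combinatorics.SetFamily.Intersecting
import Mathlib.Combinatorics.SetFamily.HarrisKleitman
import Mathlib.Data.Finset.Sups
import Mathlib.Tactic.Linarith

/-!
# `NoHeavyLowerTail` (crux stmt-CriticalPhenomena-4575), lane prim-ineq-gen-4 (gen 32): gen 31's Conjecture (V) holds at `n = 2r + 1` (Harris–Kleitman)

Support file (`--supports stmt-CriticalPhenomena-4575`; memo `run/shared/lean/prim/prim-ineq-gen-4/FINDING-COVER-MATCHING-g32.md` §5).
Pure finite combinatorics, no definitions, no `sorry`, standard axioms.

CONTEXT.  Gen 31 (memo FINDING-PRINCIPAL-AND-CROSS-SPERNER-g31 §0(3)) reformulated the self-dual slice of the anti-band conjecture as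
CONJECTURE (V): for `r < n/2` and two intersecting families `F, G` of non-empty sets of size `≤ r` in `[n]` that are cross-Sperner (no member of one is
contained in a member of the other), `#F + #G ≤ 2 Σ_{j<r} C(n−2, j)`; verified exhaustively for small `(n, r)` and conjectured in general.  At `n = 2r+1` the
bound is `2^{2r−1}` and (V) is a THEOREM, three lines from the Harris–Kleitman inequality:

**THEOREM (`card_add_card_le_of_intersecting_crossSperner`).**  Let `F, G` be intersecting families of subsets of `Fin (2r+1)` of size `≤ r`, with
`¬ f ⊆ g` and `¬ g ⊆ f` for all `f ∈ F`, `g ∈ G`.  Then `2·(#F + #G) ≤ 2^{2r}`.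
PROOF.  `F ∪ {gᶜ}` is intersecting (`#(g ∪ g') ≤ 2r < 2r+1`; `f ∩ gᶜ = ∅ ⇔ f ⊆ g`), so it extends to a maximal intersecting family `S` (`2·#S = 2^{2r+1}`,
an up-set, containing exactly one of `x, xᶜ` for every `x`); likewise `G ∪ {fᶜ} ⊆ S'`.  Then `F ⊆ (S ∖ S') ∩ {#x ≤ r}` and `G ⊆ (S' ∖ S) ∩ {#x ≤ r}`, and
`x ↦ xᶜ` maps `(S' ∖ S) ∩ {#x ≤ r}` injectively into `(S ∖ S') ∩ {#x > r}`; hence `#F + #G ≤ #(S ∖ S') = #S − #(S ∩ S') ≤ 2^{2r} − 2^{2r−1}` by Harris–Kleitman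
(`#S·#S' ≤ 2^{2r+1}·#(S ∩ S')`).  (For `n ≥ 2r+2` the same extension shows that (V) is EQUIVALENT to the anti-band inequality for self-dual pairs; memo §5.)
-/

namespace Summit.CriticalPhenomena.PercolationContinuityZ3.Theorems.AntiBandCrossSpernerOdd

open Finset

/-- In a maximal intersecting family (`2·#S = 2^n`) every set or its complement is a member. [folklore] -/
theorem mem_or_compl_mem_of_intersecting_card {n : ℕ} (S : Finset (Finset (Fin n)))
    (hS : (S : Set (Finset (Fin n))).Intersecting) (hcard : 2 * #S = 2 ^ n) (x : Finset (Fin n)) :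
    x ∈ S ∨ xᶜ ∈ S := by
  classical
  by_contra h
  rw [not_or] at h
  -- `S` and its complements are disjoint families missing `x`
  have hdisj : Disjoint S (S.image compl) := by
    rw [disjoint_left]
    intro a ha ha'
    obtain ⟨b, hb, rfl⟩ := mem_image.1 ha'
    exact hS.compl_notMem hb ha
  have hcard2 : #(S ∪ S.image compl) = 2 ^ n := by
    rw [card_union_of_disjoint hdisj, card_image_of_injective _ compl_injective, ← two_mul, hcard]
  have hsub : S ∪ S.image compl ⊆ univ.erase x := by
    intro a ha
    rw [mem_erase]
    refine ⟨?_, mem_univ _⟩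
    rintro rfl
    rcases mem_union.1 ha with h1 | h1
    · exact h.1 h1
    · obtain ⟨b, hb, hba⟩ := mem_image.1 h1
      apply h.2
      rw [← hba, compl_compl]
      exact hb
  have := card_le_card hsub
  rw [hcard2, card_erase_of_mem (mem_univ _), card_univ, Fintype.card_finset, Fintype.card_fin] at this
  have hpos : 0 < 2 ^ n := Nat.two_pow_pos n
  omega

/-- **Conjecture (V) of gen 31 at `n = 2r+1` (a theorem; Harris–Kleitman).**  For intersecting families `F, G` of subsets of `Fin (2r+1)` of size `≤ r` that are
cross-Sperner (`¬ f ⊆ g`, `¬ g ⊆ f`): `2·(#F + #G) ≤ 2^{2r}`, i.e. `#F + #G ≤ 2^{2r−1} = 2 Σ_{j<r} C(2r−1, j)`. [this work; memo FINDING-COVER-MATCHING-g32 §5] -/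
theorem card_add_card_le_of_intersecting_crossSperner (r : ℕ) (F G : Finset (Finset (Fin (2 * r + 1))))
    (hF : (F : Set (Finset (Fin (2 * r + 1)))).Intersecting) (hG : (G : Set (Finset (Fin (2 * r + 1)))).Intersecting)
    (hFr : ∀ f ∈ F, #f ≤ r) (hGr : ∀ g ∈ G, #g ≤ r)
    (hcross : ∀ f ∈ F, ∀ g ∈ G, ¬ f ⊆ g ∧ ¬ g ⊆ f) :
    2 * (#F + #G) ≤ 2 ^ (2 * r) := by
  classical
  -- Step 1: `F ∪ Gᶜ` and `G ∪ Fᶜ` are intersecting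
  have hunion : ∀ (F G : Finset (Finset (Fin (2 * r + 1)))), (F : Set (Finset (Fin (2 * r + 1)))).Intersecting →
      (∀ g ∈ G, #g ≤ r) → (∀ f ∈ F, ∀ g ∈ G, ¬ f ⊆ g) →
      ((F ∪ G.image compl : Finset (Finset (Fin (2 * r + 1)))) : Set (Finset (Fin (2 * r + 1)))).Intersecting := by
    intro F G hF hGr hcr a ha b hb hab
    rw [mem_coe, mem_union] at ha hb
    rcases ha with ha | ha <;> rcases hb with hb | hb
    · exact hF ha hb hab
    · obtain ⟨g, hg, rfl⟩ := mem_image.1 hb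
      exact hcr a ha g hg (disjoint_compl_right_iff.1 hab)
    · obtain ⟨g, hg, rfl⟩ := mem_image.1 ha
      exact hcr b hb g hg (disjoint_compl_right_iff.1 hab.symm)
    · obtain ⟨g, hg, rfl⟩ := mem_image.1 ha
      obtain ⟨g', hg', rfl⟩ := mem_image.1 hb
      -- `gᶜ ∩ g'ᶜ = ∅` would force `g ∪ g' = univ`, impossible by size
      have h1 : gᶜ ∩ g'ᶜ = ∅ := disjoint_iff_inter_eq_empty.1 hab
      have h3 : g ∪ g' = univ := by
        rw [← compl_eq_empty_iff, compl_union]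
        exact h1
      have h4 : #(g ∪ g') ≤ #g + #g' := card_union_le g g'
      rw [h3, card_univ, Fintype.card_fin] at h4
      have := hGr g hg; have := hGr g' hg'
      omega
  have hA : ((F ∪ G.image compl : Finset (Finset (Fin (2 * r + 1)))) : Set (Finset (Fin (2 * r + 1)))).Intersecting :=
    hunion F G hF hGr fun f hf g hg => (hcross f hf g hg).1
  have hA' : ((G ∪ F.image compl : Finset (Finset (Fin (2 * r + 1)))) : Set (Finset (Fin (2 * r + 1)))).Intersecting :=
    hunion G F hG hFr fun g hg f hf => (hcross f hf g hg).2
  -- Step 2: maximal intersecting extensions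
  have hcardα : Fintype.card (Finset (Fin (2 * r + 1))) = 2 ^ (2 * r + 1) := by
    rw [Fintype.card_finset, Fintype.card_fin]
  obtain ⟨S, hAS, hScard, hS⟩ := hA.exists_card_eq
  obtain ⟨S', hAS', hS'card, hS'⟩ := hA'.exists_card_eq
  have hSup : IsUpperSet (S : Set (Finset (Fin (2 * r + 1)))) :=
    hS.isUpperSet' ((hS.is_max_iff_card_eq).2 hScard)
  have hS'up : IsUpperSet (S' : Set (Finset (Fin (2 * r + 1)))) :=
    hS'.isUpperSet' ((hS'.is_max_iff_card_eq).2 hS'card)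
  rw [hcardα] at hScard hS'card
  -- Step 3: Harris–Kleitman
  have hHK : #S * #S' ≤ 2 ^ (2 * r + 1) * #(S ∩ S') := by
    have := hSup.le_card_inter_finset hS'up
    rwa [Fintype.card_fin] at this
  -- Step 4: `F ⊆ S \ S'`, `G ⊆ S' \ S`, and complementation maps the small part of `S' \ S` into the large part of `S \ S'`
  have hFsub : F ⊆ (S \ S').filter fun x => #x ≤ r := by
    intro f hf
    rw [mem_filter, mem_sdiff]
    refine ⟨⟨hAS (mem_union_left _ hf), fun hfS' => ?_⟩, hFr f hf⟩
    exact hS'.notMem (hAS' (mem_union_right _ (mem_image_of_mem _ hf))) hfS'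
  have hGsub : G ⊆ (S' \ S).filter fun x => #x ≤ r := by
    intro g hg
    rw [mem_filter, mem_sdiff]
    refine ⟨⟨hAS' (mem_union_left _ hg), fun hgS => ?_⟩, hGr g hg⟩
    exact hS.notMem (hAS (mem_union_right _ (mem_image_of_mem _ hg))) hgS
  have hcomplmap : #((S' \ S).filter fun x => #x ≤ r) ≤ #((S \ S').filter fun x => ¬ #x ≤ r) := by
    refine card_le_card_of_injOn compl ?_ ?_
    · intro x hx
      rw [mem_coe, mem_filter, mem_sdiff] at hx ⊢
      obtain ⟨⟨hxS', hxS⟩, hxr⟩ := hx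
      refine ⟨⟨?_, hS'.compl_notMem hxS'⟩, ?_⟩
      · rcases mem_or_compl_mem_of_intersecting_card S hS hScard x with h | h
        · exact absurd h hxS
        · exact h
      · rw [card_compl, Fintype.card_fin]
        have : #x ≤ 2 * r + 1 := by
          have := card_le_univ x; rwa [Fintype.card_fin] at this
        omega
    · intro x _ y _ hxy
      exact compl_injective hxy
  -- Step 5: count
  have hsplit : #((S \ S').filter fun x => #x ≤ r) + #((S \ S').filter fun x => ¬ #x ≤ r) = #(S \ S') :=
    card_filter_add_card_filter_not _
  have hsdiff : #(S \ S') + #(S ∩ S') = #S := card_sdiff_add_card_inter S S'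
  have h1 := card_le_card hFsub
  have h2 := card_le_card hGsub
  have hpow : 2 ^ (2 * r + 1) = 2 * 2 ^ (2 * r) := by rw [pow_succ, mul_comm]
  have hs : #S = 2 ^ (2 * r) := by omega
  have hs' : #S' = 2 ^ (2 * r) := by omega
  -- from Harris: `#S ≤ 2·#(S ∩ S')`
  have hi : 2 ^ (2 * r) ≤ 2 * #(S ∩ S') := by
    rw [hs, hs', hpow] at hHK
    have hp : 0 < 2 ^ (2 * r) := Nat.two_pow_pos _
    nlinarith
  omega

end Summit.CriticalPhenomena.PercolationContinuityZ3.Theorems.AntiBandCrossSpernerOdd
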